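import Literature.NumberTheory.EllipticCurves.CuspFormLFunctionEulerProductProofs
import Literature.NumberTheory.EllipticCurves.CuspFormLFunctionProofs
import Literature.NumberTheory.LFunctions.DirichletSeriesTwistedZero
import Mathlib.Analysis.SpecialFunctions.Complex.LogBounds
import HarnessLib

/-!
# Booker–Thorne at level one: twisted Euler products of newforms and their logarithms

Sibling of `DavenportHeilbronnDegreeTwo.lean` (barrier catalogue, D-0021), part of the proof of
`Literature.Barriers.RiemannHypothesis.BookerThorne2014_levelOne_zeros` /
`BookerThorne2014_thm1_levelOne` along the printed architecture (Booker–Thorne, *Zeros of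
`L`-functions outside the critical strip*, Algebra Number Theory 8 (2014), §2.1 and the proof of
Prop. 8); everything here is PROVED, there are no definitions and no named facts.

For a newform `g ∈ S_k(SL(2, ℤ))` (the tree's `IsNewform0` on `Γ₀(1)`) and a completely
multiplicative unimodular twist `e` the local factors of [BookerThorne2014], §2.1, at
`s' = s − (k−1)/2`, `e(p) = p^{-it_p}`, are `(1 − a_g(p) e(p) p^{-s'} + p^{k−1} e(p)² p^{-2s'})⁻¹`:

* `hasProd_twisted_cuspCoeff` — the twisted Euler product on Rankin's half-plane
  `Re s' > (k+1)/2` (unconditional: tree's `LSeries_hasProd_of_recurrence`, Hecke recursion,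
  Rankin's abscissa);
* under the **Ramanujan bound `|a_g(p)| ≤ 2 p^{(k−1)/2}`** at the prime `p` (Deligne's theorem, an
  explicit hypothesis `hR` here — the tree's unproved named fact
  `Literature.NumberTheory.EllipticCurves.ModularForms.Deligne1974_heckeT_eigenvalue_norm_le`
  supplies it): with `x_p = p^{-(σ'−(k−1)/2)}`, `norm_local_terms`, `norm_local_le_half`
  (`p ≥ 5`), `norm_one_sub_local_one_bounds` (trivial phase), the linearisation
  `‖−log(1 − u) − a_g(p) ε p^{-σ'}‖ ≤ 6 x_p²` ("`log L(s,π_{j,p}) − λ_j(p)p^{-s} = O(p^{-2})`",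
  `norm_neg_log_sub_linear_le`), the sizes `‖−log(1−u)‖ ≤ 4x_p` (`p ≥ 5`) and `≤ log 4 + π`
  (trivial phase), the summability of the local logarithms over the primes and
  **`L = exp ∑_p log`** (`LSeries_twisted_eq_exp_tsum`, for twists trivial at `p < 5`).

## References

* [BookerThorne2014] A. R. Booker, F. Thorne, Algebra Number Theory 8 (2014), 2027–2042, §2.1
  and the proof of Prop. 8 (arXiv:1306.6362, read).
* [Deligne1974] P. Deligne, *La conjecture de Weil. I*, Publ. Math. IHÉS 43 (1974), Thm. 8.2.
-/

noncomputable section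

open Complex Filter Topology CongruenceSubgroup
open scoped MatrixGroups
open Literature.NumberTheory.EllipticCurves.ModularForms
open Literature.NumberTheory.LFunctions

namespace Literature.Barriers.RiemannHypothesis

namespace BookerThorne2014

variable {k : ℤ}

/-! ### The twisted Euler product of a level-one newform -/

/-- **Twisted Euler product.** For a newform `g` of level one, a completely multiplicative
unimodular `e` and `Re s > (k+1)/2`:
`∑ a_g(n) e(n) n^{-s} = ∏_p (1 − a_g(p) e(p) p^{-s} + p^{k−1} e(p)² p^{-2s})⁻¹`
(coprime multiplicativity and the Hecke recursion at prime powers, Diamond–Shurman Prop. 5.8.5,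
twisted by `e`; absolute convergence on Rankin's half-plane). These are the local factors
`L(s + it_p, π_{g,p})` of [BookerThorne2014], §2.1, at `s − (k−1)/2` with `e(p) = p^{-it_p}`.
[cite: BookerThorne2014, §2.1] -/
theorem hasProd_twisted_cuspCoeff {g : CuspForm (Gamma0 1) k} (hg : IsNewform0 g) {e : ℕ →*₀ ℂ}
    (he : ∀ p, p.Prime → ‖e p‖ = 1) {s : ℂ} (hs : ((k : ℝ) + 1) / 2 < s.re) :
    HasProd (fun p : Nat.Primes ↦
      (1 - cuspCoeff g p * e p * (p : ℂ) ^ (-s) +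
        (p : ℂ) ^ (k - 1) * (e p) ^ 2 * ((p : ℂ) ^ (-s)) ^ 2)⁻¹)
      (LSeries (fun n ↦ cuspCoeff g n * e n) s) := by
  have h1 : cuspCoeff g 1 * e 1 = 1 := by
    rw [map_one, mul_one]
    exact hg.2.2
  have hmul : ∀ {m n : ℕ}, m.Coprime n →
      cuspCoeff g (m * n) * e (m * n) = (cuspCoeff g m * e m) * (cuspCoeff g n * e n) := by
    intro m n hmn
    have hc : cuspCoeff g (m * n) = cuspCoeff g m * cuspCoeff g n :=
      IsNewform0.coeff_mul_of_coprime_holds hg hmn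
    rw [hc, map_mul]
    ring
  have hrec : ∀ {p : ℕ}, p.Prime → ∀ r : ℕ,
      cuspCoeff g (p ^ (r + 2)) * e (p ^ (r + 2)) =
        (cuspCoeff g p * e p) * (cuspCoeff g (p ^ (r + 1)) * e (p ^ (r + 1))) -
          ((p : ℂ) ^ (k - 1) * (e p) ^ 2) * (cuspCoeff g (p ^ r) * e (p ^ r)) := by
    intro p hp r
    rw [hg.cuspCoeff_prime_pow_add_two_weight hp r, if_neg hp.not_dvd_one, map_pow, map_pow,
      map_pow]
    ring
  have hsum : LSeriesSummable (fun n ↦ cuspCoeff g n * e n) s :=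
    TwistedZero.LSeriesSummable_mul_twist he
      (LSeriesSummable_cuspCoeff_of_lt_re (strictWidthInfty_Gamma0 1) g hs)
  have h := Literature.NumberTheory.Automorphic.LSeries_hasProd_of_recurrence
    (a := fun n ↦ cuspCoeff g n * e n)
    (e := fun p ↦ (p : ℂ) ^ (k - 1) * (e p) ^ 2) h1 hmul (fun hp r ↦ hrec hp r) hsum
  refine h.congr_fun fun p ↦ ?_
  ring

/-! ### The local factor: non-vanishing and size, under the Ramanujan bound -/

/-- The real parameter `x_p = p^{-(σ' − (k−1)/2)}` controls the local factor at `p`: under the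
Ramanujan bound `|a_g(p)| ≤ 2 p^{(k−1)/2}` and for a unimodular `ε`,
`‖a_g(p) ε p^{-σ'}‖ ≤ 2 x_p` and `‖p^{k−1} ε² p^{-2σ'}‖ = x_p²`. [folklore] -/
theorem norm_local_terms {g : CuspForm (Gamma0 1) k} {p : ℕ} (hp : p.Prime)
    (hR : ‖cuspCoeff g p‖ ≤ 2 * (p : ℝ) ^ (((k : ℝ) - 1) / 2)) {ε : ℂ} (hε : ‖ε‖ = 1) (σ' : ℝ) :
    ‖cuspCoeff g p * ε * (p : ℂ) ^ (-(σ' : ℂ))‖ ≤ 2 * (p : ℝ) ^ (-(σ' - ((k : ℝ) - 1) / 2)) ∧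
    ‖(p : ℂ) ^ (k - 1) * ε ^ 2 * ((p : ℂ) ^ (-(σ' : ℂ))) ^ 2‖ =
      ((p : ℝ) ^ (-(σ' - ((k : ℝ) - 1) / 2))) ^ 2 := by
  have hp0 : (0 : ℝ) < p := by exact_mod_cast hp.pos
  have hX : ‖(p : ℂ) ^ (-(σ' : ℂ))‖ = (p : ℝ) ^ (-σ') := by
    rw [norm_natCast_cpow_of_pos hp.pos]
    simp
  constructor
  · rw [norm_mul, norm_mul, hε, mul_one, hX]
    calc ‖cuspCoeff g p‖ * (p : ℝ) ^ (-σ') ≤ 2 * (p : ℝ) ^ (((k : ℝ) - 1) / 2) * (p : ℝ) ^ (-σ') :=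
          mul_le_mul_of_nonneg_right hR (by positivity)
      _ = 2 * (p : ℝ) ^ (-(σ' - ((k : ℝ) - 1) / 2)) := by
          rw [mul_assoc, ← Real.rpow_add hp0]
          congr 2
          ring
  · rw [norm_mul, norm_mul, norm_pow, hε, one_pow, mul_one, norm_pow, hX, norm_zpow,
      Complex.norm_natCast, ← Real.rpow_intCast]
    push_cast
    rw [← Real.rpow_natCast ((p : ℝ) ^ (-σ')) 2, ← Real.rpow_mul hp0.le,
      ← Real.rpow_natCast _ 2, ← Real.rpow_mul hp0.le, ← Real.rpow_add hp0]
    congr 1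
    push_cast
    ring

/-- For `σ' ≥ (k−1)/2 + 1` the parameter `x_p = p^{-(σ'−(k−1)/2)}` is at most `1/p ≤ 1/2`; for
`p ≥ 5` it is at most `1/5`. [folklore] -/
theorem rpow_param_le {p : ℕ} (hp : p.Prime) {σ' : ℝ} (hσ' : ((k : ℝ) - 1) / 2 + 1 ≤ σ') :
    (p : ℝ) ^ (-(σ' - ((k : ℝ) - 1) / 2)) ≤ 1 / p := by
  have hp1 : (1 : ℝ) ≤ p := by exact_mod_cast hp.one_lt.le
  calc (p : ℝ) ^ (-(σ' - ((k : ℝ) - 1) / 2)) ≤ (p : ℝ) ^ (-(1 : ℝ)) :=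
        Real.rpow_le_rpow_of_exponent_le hp1 (by linarith)
    _ = 1 / p := by rw [Real.rpow_neg_one, one_div]

/-- For `p ≥ 5`, `σ' ≥ (k−1)/2 + 1`, a unimodular `ε` and under the Ramanujan bound, the
"local term" `u = a_g(p) ε p^{-σ'} − p^{k−1} ε² p^{-2σ'}` has `‖u‖ ≤ 1/2`.
[cite: BookerThorne2014, §2.1 (Ramanujan bound on the local factors)] -/
theorem norm_local_le_half {g : CuspForm (Gamma0 1) k} {p : ℕ} (hp : p.Prime) (hp5 : 5 ≤ p)
    (hR : ‖cuspCoeff g p‖ ≤ 2 * (p : ℝ) ^ (((k : ℝ) - 1) / 2)) {ε : ℂ} (hε : ‖ε‖ = 1) {σ' : ℝ}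
    (hσ' : ((k : ℝ) - 1) / 2 + 1 ≤ σ') :
    ‖cuspCoeff g p * ε * (p : ℂ) ^ (-(σ' : ℂ)) -
      (p : ℂ) ^ (k - 1) * ε ^ 2 * ((p : ℂ) ^ (-(σ' : ℂ))) ^ 2‖ ≤ 1 / 2 := by
  obtain ⟨h1, h2⟩ := norm_local_terms hp hR hε σ'
  set x : ℝ := (p : ℝ) ^ (-(σ' - ((k : ℝ) - 1) / 2)) with hx
  have hx0 : 0 ≤ x := by positivity
  have hxle : x ≤ 1 / 5 := by
    refine (rpow_param_le hp hσ').trans ?_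
    have : (5 : ℝ) ≤ p := by exact_mod_cast hp5
    exact one_div_le_one_div_of_le (by norm_num) this
  calc _ ≤ ‖cuspCoeff g p * ε * (p : ℂ) ^ (-(σ' : ℂ))‖ +
        ‖(p : ℂ) ^ (k - 1) * ε ^ 2 * ((p : ℂ) ^ (-(σ' : ℂ))) ^ 2‖ := norm_sub_le _ _
    _ ≤ 2 * x + x ^ 2 := by rw [h2]; linarith [h1]
    _ ≤ 1 / 2 := by nlinarith

/-- The untwisted quadratic term is the positive real number `x_p² = p^{k−1} p^{-2σ'}`.
[folklore] -/
theorem local_sq_term_eq_ofReal {p : ℕ} (hp : p.Prime) (σ' : ℝ) :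
    (p : ℂ) ^ (k - 1) * (1 : ℂ) ^ 2 * ((p : ℂ) ^ (-(σ' : ℂ))) ^ 2 =
      ((((p : ℝ) ^ (-(σ' - ((k : ℝ) - 1) / 2))) ^ 2 : ℝ) : ℂ) := by
  have hp0 : (0 : ℝ) < p := by exact_mod_cast hp.pos
  have hpC : (p : ℂ) ≠ 0 := by exact_mod_cast hp.ne_zero
  have hR : ((((p : ℝ) ^ (-(σ' - ((k : ℝ) - 1) / 2))) ^ 2 : ℝ) : ℂ) =
      (p : ℂ) ^ (((k - 1 : ℤ) : ℂ) + (2 : ℕ) * (-(σ' : ℂ))) := by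
    rw [← Real.rpow_natCast _ 2, ← Real.rpow_mul hp0.le, Complex.ofReal_cpow hp0.le]
    push_cast
    ring_nf
  rw [hR, one_pow, mul_one, ← cpow_nat_mul, ← cpow_intCast, ← cpow_add _ _ hpC]

/-- **The untwisted local factor does not vanish** for `σ' ≥ (k−1)/2 + 1` under the Ramanujan
bound: `1/4 ≤ ‖1 − a_g(p) p^{-σ'} + p^{k−1} p^{-2σ'}‖ ≤ 9/4` (indeed `≥ (1 − x_p)²` since the
quadratic term is the positive real `x_p²` and `‖a_g(p) p^{-σ'}‖ ≤ 2x_p`, `x_p ≤ 1/2`).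
[cite: BookerThorne2014, §2.1] -/
theorem norm_one_sub_local_one_bounds {g : CuspForm (Gamma0 1) k} {p : ℕ} (hp : p.Prime)
    (hR : ‖cuspCoeff g p‖ ≤ 2 * (p : ℝ) ^ (((k : ℝ) - 1) / 2)) {σ' : ℝ}
    (hσ' : ((k : ℝ) - 1) / 2 + 1 ≤ σ') :
    1 / 4 ≤ ‖1 - (cuspCoeff g p * 1 * (p : ℂ) ^ (-(σ' : ℂ)) -
      (p : ℂ) ^ (k - 1) * (1 : ℂ) ^ 2 * ((p : ℂ) ^ (-(σ' : ℂ))) ^ 2)‖ ∧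
    ‖1 - (cuspCoeff g p * 1 * (p : ℂ) ^ (-(σ' : ℂ)) -
      (p : ℂ) ^ (k - 1) * (1 : ℂ) ^ 2 * ((p : ℂ) ^ (-(σ' : ℂ))) ^ 2)‖ ≤ 9 / 4 := by
  obtain ⟨h1, h2⟩ := norm_local_terms hp hR (ε := 1) norm_one σ'
  set x : ℝ := (p : ℝ) ^ (-(σ' - ((k : ℝ) - 1) / 2)) with hx
  have hx0 : 0 ≤ x := by positivity
  have hxle : x ≤ 1 / 2 := by
    refine (rpow_param_le hp hσ').trans ?_
    have : (2 : ℝ) ≤ p := by exact_mod_cast hp.two_le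
    rw [div_le_div_iff₀ (by positivity) two_pos]
    linarith
  set A : ℂ := cuspCoeff g p * 1 * (p : ℂ) ^ (-(σ' : ℂ)) with hA
  have hB : (p : ℂ) ^ (k - 1) * (1 : ℂ) ^ 2 * ((p : ℂ) ^ (-(σ' : ℂ))) ^ 2 = ((x ^ 2 : ℝ) : ℂ) :=
    local_sq_term_eq_ofReal hp σ'
  rw [hB]
  have heq : (1 : ℂ) - (A - ((x ^ 2 : ℝ) : ℂ)) = ((1 + x ^ 2 : ℝ) : ℂ) - A := by push_cast; ring
  rw [heq]
  constructor
  · have := norm_sub_norm_le (((1 + x ^ 2 : ℝ) : ℂ)) A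
    rw [Complex.norm_real, Real.norm_of_nonneg (by positivity)] at this
    nlinarith
  · calc ‖((1 + x ^ 2 : ℝ) : ℂ) - A‖ ≤ ‖((1 + x ^ 2 : ℝ) : ℂ)‖ + ‖A‖ := norm_sub_le _ _
      _ ≤ (1 + x ^ 2) + 2 * x := by
          rw [Complex.norm_real, Real.norm_of_nonneg (by positivity)]
          linarith [h1]
      _ ≤ 9 / 4 := by nlinarith

/-! ### Logarithms of the local factors -/

/-- `(1 − u)⁻¹ = exp(−log(1 − u))` for `u ≠ 1`. [folklore] -/
theorem inv_one_sub_eq_exp_neg_log {u : ℂ} (hu : 1 - u ≠ 0) :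
    (1 - u)⁻¹ = cexp (-log (1 - u)) := by
  rw [Complex.exp_neg, Complex.exp_log hu]

/-- **Linearisation of the local logarithm** ([BookerThorne2014], proof of Prop. 8: "By the
Ramanujan bound, we have `log L(s, π_{j,p}) − λ_j(p) p^{-s} = O(p^{-2})` uniformly for
`Re(s) ≥ 1`"): for `p ≥ 5`, `σ' ≥ (k−1)/2 + 1`, unimodular `ε`,
`‖−log(1 − u) − a_g(p) ε p^{-σ'}‖ ≤ 6 x_p²` with `x_p = p^{-(σ'−(k−1)/2)} ≤ 1/p`.
[cite: BookerThorne2014, proof of Prop. 8] -/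
theorem norm_neg_log_sub_linear_le {g : CuspForm (Gamma0 1) k} {p : ℕ} (hp : p.Prime)
    (hp5 : 5 ≤ p) (hR : ‖cuspCoeff g p‖ ≤ 2 * (p : ℝ) ^ (((k : ℝ) - 1) / 2)) {ε : ℂ} (hε : ‖ε‖ = 1)
    {σ' : ℝ} (hσ' : ((k : ℝ) - 1) / 2 + 1 ≤ σ') :
    ‖-log (1 - (cuspCoeff g p * ε * (p : ℂ) ^ (-(σ' : ℂ)) -
        (p : ℂ) ^ (k - 1) * ε ^ 2 * ((p : ℂ) ^ (-(σ' : ℂ))) ^ 2)) -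
      cuspCoeff g p * ε * (p : ℂ) ^ (-(σ' : ℂ))‖ ≤
      6 * ((p : ℝ) ^ (-(σ' - ((k : ℝ) - 1) / 2))) ^ 2 := by
  obtain ⟨h1, h2⟩ := norm_local_terms hp hR hε σ'
  have hu := norm_local_le_half hp hp5 hR hε hσ'
  set x : ℝ := (p : ℝ) ^ (-(σ' - ((k : ℝ) - 1) / 2)) with hx
  set A : ℂ := cuspCoeff g p * ε * (p : ℂ) ^ (-(σ' : ℂ)) with hA
  set B : ℂ := (p : ℂ) ^ (k - 1) * ε ^ 2 * ((p : ℂ) ^ (-(σ' : ℂ))) ^ 2 with hB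
  have hx0 : 0 ≤ x := by positivity
  have hxle : x ≤ 1 / 5 := by
    refine (rpow_param_le hp hσ').trans ?_
    have : (5 : ℝ) ≤ p := by exact_mod_cast hp5
    exact one_div_le_one_div_of_le (by norm_num) this
  have hAB : ‖A - B‖ ≤ 2 * x + x ^ 2 := by
    calc ‖A - B‖ ≤ ‖A‖ + ‖B‖ := norm_sub_le _ _
      _ ≤ 2 * x + x ^ 2 := by rw [h2]; linarith [h1]
  have hlt : ‖A - B‖ < 1 := lt_of_le_of_lt hu (by norm_num)
  -- `-log(1 - u) = log (1 - u)⁻¹`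
  have hslit : 1 - (A - B) ∈ slitPlane := by
    rw [sub_eq_add_neg]
    exact mem_slitPlane_of_norm_lt_one (by rwa [norm_neg])
  have hneg : -log (1 - (A - B)) = log (1 - (A - B))⁻¹ :=
    (Complex.log_inv _ (slitPlane_arg_ne_pi hslit)).symm
  rw [hneg]
  have hmain := norm_log_one_sub_inv_sub_self_le hlt
  have hmain' : ‖log (1 - (A - B))⁻¹ - (A - B)‖ ≤ ‖A - B‖ ^ 2 := by
    refine hmain.trans ?_
    have h3 : (1 - ‖A - B‖)⁻¹ ≤ 2 := by
      rw [inv_le_comm₀ (by linarith) two_pos]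
      linarith
    have h4 : 0 ≤ ‖A - B‖ ^ 2 := by positivity
    calc ‖A - B‖ ^ 2 * (1 - ‖A - B‖)⁻¹ / 2 ≤ ‖A - B‖ ^ 2 * 2 / 2 := by gcongr
      _ = ‖A - B‖ ^ 2 := by ring
  calc ‖log (1 - (A - B))⁻¹ - A‖ = ‖(log (1 - (A - B))⁻¹ - (A - B)) - B‖ := by ring_nf
    _ ≤ ‖log (1 - (A - B))⁻¹ - (A - B)‖ + ‖B‖ := norm_sub_le _ _
    _ ≤ ‖A - B‖ ^ 2 + x ^ 2 := by rw [h2]; linarith [hmain']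
    _ ≤ (2 * x + x ^ 2) ^ 2 + x ^ 2 := by gcongr
    _ ≤ 6 * x ^ 2 := by
        have h3 : x * x ^ 2 ≤ 1 / 5 * x ^ 2 := mul_le_mul_of_nonneg_right hxle (sq_nonneg x)
        have h4 : x ^ 2 * x ^ 2 ≤ 1 / 25 * x ^ 2 :=
          mul_le_mul_of_nonneg_right (by nlinarith) (sq_nonneg x)
        nlinarith [h3, h4]

/-- **Size of the local logarithm, large primes**: for `p ≥ 5`, `σ' ≥ (k−1)/2 + 1` and a
unimodular `ε`, `‖−log(1 − u)‖ ≤ 4 x_p`. [cite: BookerThorne2014, proof of Prop. 8] -/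
theorem norm_neg_log_local_le {g : CuspForm (Gamma0 1) k} {p : ℕ} (hp : p.Prime)
    (hp5 : 5 ≤ p) (hR : ‖cuspCoeff g p‖ ≤ 2 * (p : ℝ) ^ (((k : ℝ) - 1) / 2)) {ε : ℂ} (hε : ‖ε‖ = 1)
    {σ' : ℝ} (hσ' : ((k : ℝ) - 1) / 2 + 1 ≤ σ') :
    ‖-log (1 - (cuspCoeff g p * ε * (p : ℂ) ^ (-(σ' : ℂ)) -
        (p : ℂ) ^ (k - 1) * ε ^ 2 * ((p : ℂ) ^ (-(σ' : ℂ))) ^ 2))‖ ≤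
      4 * (p : ℝ) ^ (-(σ' - ((k : ℝ) - 1) / 2)) := by
  obtain ⟨h1, h2⟩ := norm_local_terms hp hR hε σ'
  have hu := norm_local_le_half hp hp5 hR hε hσ'
  set x : ℝ := (p : ℝ) ^ (-(σ' - ((k : ℝ) - 1) / 2)) with hx
  set u : ℂ := cuspCoeff g p * ε * (p : ℂ) ^ (-(σ' : ℂ)) -
    (p : ℂ) ^ (k - 1) * ε ^ 2 * ((p : ℂ) ^ (-(σ' : ℂ))) ^ 2 with hudef
  have hx0 : 0 ≤ x := by positivity
  have hxle : x ≤ 1 / 5 := by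
    refine (rpow_param_le hp hσ').trans ?_
    have : (5 : ℝ) ≤ p := by exact_mod_cast hp5
    exact one_div_le_one_div_of_le (by norm_num) this
  have hule : ‖u‖ ≤ 2 * x + x ^ 2 := by
    calc ‖u‖ ≤ ‖cuspCoeff g p * ε * (p : ℂ) ^ (-(σ' : ℂ))‖ +
          ‖(p : ℂ) ^ (k - 1) * ε ^ 2 * ((p : ℂ) ^ (-(σ' : ℂ))) ^ 2‖ := norm_sub_le _ _
      _ ≤ 2 * x + x ^ 2 := by rw [h2]; linarith [h1]
  rw [norm_neg, sub_eq_add_neg]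
  calc ‖log (1 + -u)‖ ≤ 3 / 2 * ‖-u‖ := norm_log_one_add_half_le_self (by rwa [norm_neg])
    _ = 3 / 2 * ‖u‖ := by rw [norm_neg]
    _ ≤ 3 / 2 * (2 * x + x ^ 2) := by gcongr
    _ ≤ 4 * x := by nlinarith

/-- **Size of the local logarithm, any prime, trivial twist**: for `σ' ≥ (k−1)/2 + 1`,
`‖log(1 − a_g(p) p^{-σ'} + p^{k-1} p^{-2σ'})‖ ≤ log 4 + π` (the factor has modulus in
`[1/4, 9/4]`). [cite: BookerThorne2014, proof of Prop. 8 (the primes `y < p ≤ Y`)] -/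
theorem norm_log_local_one_le {g : CuspForm (Gamma0 1) k} {p : ℕ} (hp : p.Prime)
    (hR : ‖cuspCoeff g p‖ ≤ 2 * (p : ℝ) ^ (((k : ℝ) - 1) / 2)) {σ' : ℝ}
    (hσ' : ((k : ℝ) - 1) / 2 + 1 ≤ σ') :
    ‖-log (1 - (cuspCoeff g p * 1 * (p : ℂ) ^ (-(σ' : ℂ)) -
        (p : ℂ) ^ (k - 1) * (1 : ℂ) ^ 2 * ((p : ℂ) ^ (-(σ' : ℂ))) ^ 2))‖ ≤ Real.log 4 + Real.pi := by
  obtain ⟨hlo, hhi⟩ := norm_one_sub_local_one_bounds hp hR hσ'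
  set w : ℂ := 1 - (cuspCoeff g p * 1 * (p : ℂ) ^ (-(σ' : ℂ)) -
    (p : ℂ) ^ (k - 1) * (1 : ℂ) ^ 2 * ((p : ℂ) ^ (-(σ' : ℂ))) ^ 2) with hw
  have hw0 : 0 < ‖w‖ := lt_of_lt_of_le (by norm_num) hlo
  rw [norm_neg]
  calc ‖log w‖ ≤ |(log w).re| + |(log w).im| := norm_le_abs_re_add_abs_im _
    _ = |Real.log ‖w‖| + |arg w| := by rw [Complex.log_re, Complex.log_im]
    _ ≤ Real.log 4 + Real.pi := by
        refine add_le_add ?_ (abs_arg_le_pi w)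
        rw [abs_le]
        constructor
        · rw [← Real.log_inv]
          have : Real.log 4⁻¹ ≤ Real.log ‖w‖ := Real.log_le_log (by norm_num) (by linarith)
          linarith
        · exact Real.log_le_log hw0 (by linarith)

/-! ### Summability of the local logarithms and `L = exp ∑ log` -/

/-- The sequence `x_p = p^{-(σ'−(k−1)/2)}` is summable over the primes for
`σ' > (k−1)/2 + 1`. [folklore] -/
theorem summable_rpow_param {σ' : ℝ} (hσ' : ((k : ℝ) - 1) / 2 + 1 < σ') :
    Summable fun p : Nat.Primes ↦ ((p : ℕ) : ℝ) ^ (-(σ' - ((k : ℝ) - 1) / 2)) :=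
  Nat.Primes.summable_rpow.2 (by linarith)

/-- **The local logarithms are summable over the primes** (`σ' > (k−1)/2 + 1`, unimodular
`e`, Ramanujan bound at every prime): they are `O(x_p)`. [folklore] -/
theorem summable_neg_log_local {g : CuspForm (Gamma0 1) k} {e : ℕ → ℂ}
    (he : ∀ p, p.Prime → ‖e p‖ = 1)
    (hR : ∀ p : ℕ, p.Prime → ‖cuspCoeff g p‖ ≤ 2 * (p : ℝ) ^ (((k : ℝ) - 1) / 2)) {σ' : ℝ}
    (hσ' : ((k : ℝ) - 1) / 2 + 1 < σ') :
    Summable fun p : Nat.Primes ↦ -log (1 - (cuspCoeff g p * e p * (p : ℂ) ^ (-(σ' : ℂ)) -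
        (p : ℂ) ^ (k - 1) * (e p) ^ 2 * ((p : ℂ) ^ (-(σ' : ℂ))) ^ 2)) := by
  have hbig : ∀ p : Nat.Primes, 5 ≤ (p : ℕ) →
      ‖-log (1 - (cuspCoeff g p * e p * (p : ℂ) ^ (-(σ' : ℂ)) -
        (p : ℂ) ^ (k - 1) * (e p) ^ 2 * ((p : ℂ) ^ (-(σ' : ℂ))) ^ 2))‖ ≤
        4 * ((p : ℕ) : ℝ) ^ (-(σ' - ((k : ℝ) - 1) / 2)) := fun p hp5 ↦
    norm_neg_log_local_le p.2 hp5 (hR p p.2) (he p p.2) hσ'.le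
  refine Summable.of_norm_bounded_eventually
    (g := fun p : Nat.Primes ↦ 4 * ((p : ℕ) : ℝ) ^ (-(σ' - ((k : ℝ) - 1) / 2)))
    ((summable_rpow_param hσ').mul_left 4) ?_
  rw [Filter.eventually_cofinite]
  refine Set.Finite.subset ((Set.finite_Iio 5).preimage (Subtype.val_injective.injOn)) fun p hp ↦ ?_
  simp only [Set.mem_preimage, Set.mem_Iio] at hp ⊢
  by_contra h5
  exact hp (hbig p (not_lt.1 h5))

/-- **`L = exp ∑_p log`** for the twisted `L`-series of a level-one newform on Rankin's
half-plane: for `σ' > (k−1)/2 + 1`, a unimodular completely multiplicative `e` with `e(p) = 1`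
for `p < 5`, and the Ramanujan bound at every prime,
`∑ a_g(n) e(n) n^{-σ'} = exp(∑_p −log(1 − a_g(p) e(p) p^{-σ'} + p^{k−1} e(p)² p^{-2σ'}))`
(Euler product, each factor being `exp(−log)` of its inverse, which does not vanish).
[cite: BookerThorne2014, proof of Prop. 8 ("Taking exponentials yields the proposition")] -/
theorem LSeries_twisted_eq_exp_tsum {g : CuspForm (Gamma0 1) k} (hg : IsNewform0 g)
    {e : ℕ →*₀ ℂ} (he : ∀ p, p.Prime → ‖e p‖ = 1) (he1 : ∀ p, p.Prime → p < 5 → e p = 1)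
    (hR : ∀ p : ℕ, p.Prime → ‖cuspCoeff g p‖ ≤ 2 * (p : ℝ) ^ (((k : ℝ) - 1) / 2)) {σ' : ℝ}
    (hσ' : ((k : ℝ) - 1) / 2 + 1 < σ') :
    LSeries (fun n ↦ cuspCoeff g n * e n) σ' =
      cexp (∑' p : Nat.Primes, -log (1 - (cuspCoeff g p * e p * (p : ℂ) ^ (-(σ' : ℂ)) -
        (p : ℂ) ^ (k - 1) * (e p) ^ 2 * ((p : ℂ) ^ (-(σ' : ℂ))) ^ 2))) := by
  have hs : ((k : ℝ) + 1) / 2 < ((σ' : ℂ)).re := by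
    rw [Complex.ofReal_re]
    linarith
  have hprod := hasProd_twisted_cuspCoeff hg he hs
  have hsum := (summable_neg_log_local (e := (e : ℕ → ℂ)) he hR hσ').hasSum
  have hprod' := hsum.cexp
  -- the factors agree
  have hne : ∀ p : Nat.Primes, 1 - (cuspCoeff g p * e p * (p : ℂ) ^ (-(σ' : ℂ)) -
      (p : ℂ) ^ (k - 1) * (e p) ^ 2 * ((p : ℂ) ^ (-(σ' : ℂ))) ^ 2) ≠ 0 := by
    intro p
    by_cases h5 : 5 ≤ (p : ℕ)
    · have hu := norm_local_le_half p.2 h5 (hR p p.2) (he p p.2) hσ'.le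
      intro h0
      have : ‖(1 : ℂ)‖ ≤ 1 / 2 := by
        have h1 : (1 : ℂ) = cuspCoeff g p * e p * (p : ℂ) ^ (-(σ' : ℂ)) -
            (p : ℂ) ^ (k - 1) * (e p) ^ 2 * ((p : ℂ) ^ (-(σ' : ℂ))) ^ 2 := sub_eq_zero.1 h0
        rw [h1]
        exact hu
      norm_num at this
    · have h1 : e p = 1 := he1 p p.2 (not_le.1 h5)
      rw [h1]
      have := (norm_one_sub_local_one_bounds (g := g) p.2 (hR p p.2) hσ'.le).1
      intro h0
      rw [h0, norm_zero] at this
      norm_num at this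
  have heq : (fun p : Nat.Primes ↦ (1 - cuspCoeff g p * e p * (p : ℂ) ^ (-(σ' : ℂ)) +
      (p : ℂ) ^ (k - 1) * (e p) ^ 2 * ((p : ℂ) ^ (-(σ' : ℂ))) ^ 2)⁻¹) =
      (cexp ∘ fun p : Nat.Primes ↦ -log (1 - (cuspCoeff g p * e p * (p : ℂ) ^ (-(σ' : ℂ)) -
        (p : ℂ) ^ (k - 1) * (e p) ^ 2 * ((p : ℂ) ^ (-(σ' : ℂ))) ^ 2))) := by
    funext p
    simp only [Function.comp]
    rw [← inv_one_sub_eq_exp_neg_log (hne p)]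
    congr 1
    ring
  rw [heq] at hprod
  exact hprod.unique hprod'

end BookerThorne2014

end Literature.Barriers.RiemannHypothesis
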